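import Summits.Ventures.GridStability.Lyapunov.WSCC9LossySplitSlabCast
import Summits.Ventures.GridStability.Models.LineAngleBounds
import Summits.Ventures.GridStability.Models.StructurePreservingSlabWindow
import Summits.Ventures.GridStability.Models.ClassicalSwingGlobal
import HarnessLib

/-!
# GridStability/Bench/WSCC9LossySplitSlabRoa — «G2.c-WSCC9-LOSSY-SLAB» (#35, LANE F1): the kernel-checked
# Lur'e–Postnikov SLAB certificate of sos-2 for the post-fault WSCC 3-machine classical model WITH TRANSFER
# CONDUCTANCES (Pai's split presentation), its sector facts, and the certified region (file 3/3)

Cell `gridfusion` (LADDER-GRIDFUSION G2.c lossy tier); lead 07:18:16Z «#35 — TWO LANES IN PARALLEL» / (R-b)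
08:21:31Z; director RULING 29 ADDENDUM 1 (2); seat gridfusion-lyap-2 (g0).

OBJECT: `WSCC9.splitLurieSystem` (model-1 p508678, Models/WSCC9SplitLurie.lean) = lit-6's SPLIT Lur'e system
(LossyMultimachineLurieForm §7, Pai (3.43)–(3.45)) of the instance of record «WSCC9-postB-SPdamp-h12»: the
Anderson–Fouad / Sauer–Pai WSCC 3-machine 9-bus classical model, post-fault network B Kron-reduced WITH transfer
conductances (h12 couplings), damping `D_i/M_i = 1/10, 1/5, 3/10` (S&P Ex. 7.1, MV-SPD), A1 rational equilibrium
`θ* = angleOf` (circle points); states `(ω₀, ω₁, ω₂ | σ₁, σ₂)`, 18 channels (9 sine, 9 cosine, 6 null).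
DATA: `Lyapunov/WSCC9LossySplitSlabData.lean` (p514940; sos-2 Λ `9255093d`: `u = 1/50`, `γ_lo = 4999/125000`,
`ε = 38037/2²³`, `η = 10⁻⁶`, kernel-decided Gram certificates) and `Lyapunov/WSCC9LossySplitSlabCast.lean`
(`cert : SlabCertificate WSCC9.splitLurieSystem`, `rankOne`).
WHAT IS PROVED HERE: (1) two closed-form SECTOR LEMMAS (`sector_sin_of_values`, `sector_cos_of_values`: lit-6's
`channel_sector_sin_narrow` / `channel_sector_cos` with `cos(|δ*| ± γ)`, `−sin(θ* ± γ)` expanded by the addition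
formulas into the exact channel sines/cosines `sd`, `cd` and the circle point `(cos γ, sin γ) = (2499, 100)/2501`
of `γ = 2·arctan(1/50)`); (2) the per-channel rational tests, ONE `decide` (`sector_tests`); (3) `hsec` — the
sector hypothesis of lit-6's theorem for all 18 channels on the slab `γ`; (4) `hlev` — the rank-one level
`c_rk = 1048155611943/4121792031250000 < γ²/s_k`; (5) **THE SENTENCE** `lossy_split_slab_roa` =
`WSCC9.lossy_split_roa` (model-1) ∘ lit-6 `InternalNode.lurieState_tendsto_zero_of_slabCertificate`:
**for MODEL M′ = `WSCC9.postB_SPdamp.toModel` (transfer conductances KEPT): every solution on `ℝ` whose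
initial Lur'e state lies in the open slab — all six machine-angle-difference deviations
`|(δ_p − δ_q) − (θ*_p − θ*_q)| < 2·arctan(1/50)` (≈ 2.29°, `mem_slab_iff`) — with `V ≤ lev` for any
`lev ≤ c_rk` (`V = xᵀPx + 2Σ λ_k∫F_k`, the slab Lyapunov function of `cert`) keeps both for all `t ≥ 0`, and
its Lur'e state tends to `0`: every speed deviation `ω_i → 0` and every `δ_p − δ_0 → θ*_p − θ*_0`
(`lossy_split_slab_sync`).**  The ε-level `c_ε = ε·γ_lo²/2 ≤ c_rk` is admissible too.
THREE COLUMNS. CERTIFIED (kernel, this file + p514940 + Cast): the statements below for MODEL M′, CLASS = the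
well `{slab 2·arctan(1/50), V ≤ c_rk}` (inner estimate; VALIDATED region datum: inner state ball ≈ 0.92°
at `c_rk`, ≈ 0.11° at `c_ε` — sos-2 report, not part of the claim). MODELLED «WSCC9-postB-SPdamp-h12» (MV-2 +
MV-P + MV-SPD + MV-ω + MV-h12; classical network-reduced model, constant-impedance loads, transfer conductances
KEPT; MODEL-VALIDITY rows of model-2). VALIDATED: the SDP solve (CVXOPT) and the region-size data. Nothing here
says the WSCC system or any grid is stable.
-/

noncomputable section

open Set Filter Topology Real Matrix
open Literature.MathematicalPhysics.PowerSystems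
open Literature.MathematicalPhysics.PowerSystems.LyapunovFunctionFamily
open Literature.Computation.Certificates
open Summit.Ventures.GridStability.Models
open Summit.Ventures.GridStability.Lyapunov.WSCC9LossySplitSlab

namespace Summit.Ventures.GridStability.Bench.WSCC9LossySplitSlab

/-! ### Two closed-form sector lemmas (addition formulas on lit-6's §4 interface) -/

/-- **Sine channel, narrow window, closed form.** For an equilibrium channel angle `δ*` with `|δ*| < π/2`,
`sin δ* = sd`, `cos δ* = cd`, a half-width `0 ≤ γ < π/2` with `cos γ = cg`, `sin γ = sg` and `sg ≤ |sd|`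
(so `γ ≤ |δ*|`): slopes `a ≤ cd·cg − |sd|·sg = cos(|δ*| + γ)` and `cos(|δ*| − γ) = cd·cg + |sd|·sg ≤ b` give the
sector hypothesis on `|ξ − δ*| ≤ γ`. [cite: Pai1981, §4.6 p. 117; VuTuritsyn2017, §4.1 eq. (bound)] -/
theorem sector_sin_of_values {δ γ sd cd cg sg al bu : ℝ} (hδ : |δ| < π / 2) (hγ0 : 0 ≤ γ) (hγ : γ < π / 2)
    (hs : Real.sin δ = sd) (hc : Real.cos δ = cd) (hcg : Real.cos γ = cg) (hsg : Real.sin γ = sg)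
    (hsd : sg ≤ |sd|) (ha : al ≤ cd * cg - |sd| * sg) (hb : cd * cg + |sd| * sg ≤ bu) :
    ∀ ξ, |ξ - δ| ≤ γ → al ≤ Real.cos ξ ∧ Real.cos ξ ≤ bu := by
  have hπ : |δ| + γ ≤ π := by linarith [abs_nonneg δ]
  have hcos_abs : Real.cos |δ| = cd := by rw [Real.cos_abs, hc]
  have hsin_abs : Real.sin |δ| = |sd| := by
    rcases le_or_gt 0 δ with h | h
    · have hδπ : δ ≤ π := by linarith [(abs_lt.1 hδ).2, Real.pi_pos]
      rw [abs_of_nonneg h, ← hs, abs_of_nonneg (Real.sin_nonneg_of_nonneg_of_le_pi h hδπ)]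
    · have hδπ : -π < δ := by linarith [(abs_lt.1 hδ).1, Real.pi_pos]
      rw [abs_of_neg h, Real.sin_neg, ← hs, abs_of_neg (Real.sin_neg_of_neg_of_neg_pi_lt h hδπ)]
  have hγle : γ ≤ |δ| := by
    by_contra hlt
    push Not at hlt
    have h1 : Real.sin |δ| < Real.sin γ :=
      Real.sin_lt_sin_of_lt_of_le_pi_div_two (by linarith [abs_nonneg δ, Real.pi_pos]) hγ.le hlt
    rw [hsin_abs, hsg] at h1
    linarith
  refine channel_sector_sin_narrow hπ hγle ?_ ?_
  · rw [Real.cos_add, hcos_abs, hsin_abs, hcg, hsg]; exact ha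
  · rw [Real.cos_sub, hcos_abs, hsin_abs, hcg, hsg]; exact hb

/-- **Cosine channel, closed form** (`δ* = θ* + π/2`): for `|θ*| < π/2`, `sin θ* = sd`, `cos θ* = cd`, a
half-width `γ ≤ π/2` with `cos γ = cg`, `sin γ = sg` and `sg ≤ cd` (so `|θ*| + γ ≤ π/2`): slopes
`a ≤ −(sd·cg + cd·sg) = −sin(θ* + γ)` and `−sin(θ* − γ) = −(sd·cg − cd·sg) ≤ b` give the sector hypothesis
on `|ξ − (θ* + π/2)| ≤ γ`. [cite: Pai1981, §3.6.3 eq. (3.44) and §4.7.3 (4.115); VuTuritsyn2017, §4.1] -/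
theorem sector_cos_of_values {θ γ sd cd cg sg al bu : ℝ} (hθ : |θ| < π / 2) (hγ : γ ≤ π / 2)
    (hs : Real.sin θ = sd) (hc : Real.cos θ = cd) (hcg : Real.cos γ = cg) (hsg : Real.sin γ = sg)
    (hcd : sg ≤ cd) (ha : al ≤ -(sd * cg + cd * sg)) (hb : -(sd * cg - cd * sg) ≤ bu) :
    ∀ ξ, |ξ - (θ + π / 2)| ≤ γ → al ≤ Real.cos ξ ∧ Real.cos ξ ≤ bu := by
  have hπ : |θ| + γ ≤ π / 2 := by
    by_contra hlt
    push Not at hlt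
    have h1 : Real.cos |θ| < Real.cos (π / 2 - γ) :=
      Real.cos_lt_cos_of_nonneg_of_le_pi (by linarith) (by linarith [abs_nonneg θ, Real.pi_pos]) (by linarith)
    rw [Real.cos_abs, hc, Real.cos_pi_div_two_sub, hsg] at h1
    linarith
  refine channel_sector_cos hπ ?_ ?_
  · rw [Real.sin_add, hs, hc, hcg, hsg]; exact ha
  · rw [Real.sin_sub, hs, hc, hcg, hsg]; exact hb

/-! ### The slab half-width `γ = 2·arctan(1/50)` and its circle point -/

/-- The declared half-width is `2·arctan u`, `u = uQ = 1/50`. -/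
theorem uQ_cast : ((uQ : ℚ) : ℝ) = 1 / 50 := by norm_num [uQ]

/-- `cos γ = cgQ = 2499/2501` and `sin γ = sgQ = 100/2501` for `γ = 2·arctan(1/50)`. -/
theorem cos_sin_gamma : Real.cos (2 * Real.arctan (1 / 50 : ℝ)) = ((cgQ : ℚ) : ℝ) ∧
    Real.sin (2 * Real.arctan (1 / 50 : ℝ)) = ((sgQ : ℚ) : ℝ) := by
  rw [Lyapunov.StructurePreserving.cos_two_mul_arctan, Lyapunov.StructurePreserving.sin_two_mul_arctan,
    circle_u.1, circle_u.2.1]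
  push_cast
  rw [uQ_cast]
  exact ⟨rfl, rfl⟩

/-- `0 ≤ γ < π/2`. -/
theorem gamma_range : 0 ≤ 2 * Real.arctan (1 / 50 : ℝ) ∧ 2 * Real.arctan (1 / 50 : ℝ) < π / 2 :=
  ⟨Lyapunov.StructurePreserving.two_mul_arctan_nonneg (by norm_num),
    Lyapunov.StructurePreserving.two_mul_arctan_lt_pi_div_two (by norm_num)⟩

/-- `γ_lo < γ` (`γ_lo²(1 + u²) ≤ 4u²`, model-2's `lt_two_arctan_of_sq_le`). -/
theorem gloQ_lt_gamma : ((gloQ : ℚ) : ℝ) < 2 * Real.arctan (1 / 50 : ℝ) := by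
  rw [← uQ_cast]
  exact StructurePreserving.lt_two_arctan_of_sq_le (by exact_mod_cast circle_u.2.2.1)
    (by exact_mod_cast glo_test.1) (by exact_mod_cast glo_test.2)

/-! ### The per-channel rational sector tests (one kernel `decide`) -/

/-- **All 18 channels' rational sector tests** against the exact channel sines/cosines `sd`, `cd` of the A1
equilibrium and the circle point `(cgQ, sgQ)`: null channels `a = −1`, `b = 1`; sine channels `sgQ ≤ |sd|`,
`a ≤ cd·cgQ − |sd|·sgQ`, `cd·cgQ + |sd|·sgQ ≤ b`; cosine channels `sgQ ≤ cd`, `a ≤ −(sd·cgQ + cd·sgQ)`,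
`−(sd·cgQ − cd·sgQ) ≤ b` (sos-2's sectors hold WITH EQUALITY; kernel). -/
theorem sector_tests : ∀ p q : Fin 3,
    (p = q → aK (Sum.inl (p, q)) = -1 ∧ bK (Sum.inl (p, q)) = 1 ∧ aK (Sum.inr (p, q)) = -1 ∧ bK (Sum.inr (p, q)) = 1) ∧
    (p ≠ q →
      (sgQ ≤ |WSCC9.postB_SPdamp.sd p q| ∧
        aK (Sum.inl (p, q)) ≤ WSCC9.postB_SPdamp.cd p q * cgQ - |WSCC9.postB_SPdamp.sd p q| * sgQ ∧
        WSCC9.postB_SPdamp.cd p q * cgQ + |WSCC9.postB_SPdamp.sd p q| * sgQ ≤ bK (Sum.inl (p, q))) ∧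
      (sgQ ≤ WSCC9.postB_SPdamp.cd p q ∧
        aK (Sum.inr (p, q)) ≤ -(WSCC9.postB_SPdamp.sd p q * cgQ + WSCC9.postB_SPdamp.cd p q * sgQ) ∧
        -(WSCC9.postB_SPdamp.sd p q * cgQ - WSCC9.postB_SPdamp.cd p q * sgQ) ≤ bK (Sum.inr (p, q)))) := by
  decide +kernel

/-! ### The equilibrium's channel angles -/

/-- `|θ*_p − θ*_q| < π/2` (all node angles acute with `s ≥ 0`, model-1 / LineAngleBounds). -/
theorem abs_angle_sub_lt (p q : Fin 3) :
    |WSCC9.postB_SPdamp.angleOf p - WSCC9.postB_SPdamp.angleOf q| < π / 2 :=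
  WSCC9.postB_SPdamp.abs_angleOf_sub_lt_pi_div_two (WSCC9.postB_SPdamp_acute.1 p)
    (WSCC9.postB_SPdamp_acute.1 q) (WSCC9.postB_SPdamp_acute.2 p) (WSCC9.postB_SPdamp_acute.2 q)

/-! ### The sector hypothesis of lit-6's theorem, all 18 channels -/

/-- **`hsec`**: on the slab `|ξ − δ*_k| ≤ γ = 2·arctan(1/50)` every channel's cosine lies in `[a_k, b_k]`
(`δ*_k = θ*_p − θ*_q` on the sine channel `inl (p,q)`, `θ*_p − θ*_q + π/2` on the cosine channel `inr (p,q)`). -/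
theorem hsec : ∀ k ξ, |ξ - InternalNode.splitShift WSCC9.postB_SPdamp.angleOf k| ≤ 2 * Real.arctan (1 / 50 : ℝ) →
    cert.a k ≤ Real.cos ξ ∧ Real.cos ξ ≤ cert.b k := by
  rintro (⟨p, q⟩ | ⟨p, q⟩) ξ hξ
  · rw [(cert_a_b _).1, (cert_a_b _).2]
    change ((aK (Sum.inl (p, q)) : ℚ) : ℝ) ≤ Real.cos ξ ∧ Real.cos ξ ≤ ((bK (Sum.inl (p, q)) : ℚ) : ℝ)
    simp only [InternalNode.splitShift, Sum.elim_inl] at hξ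
    by_cases hpq : p = q
    · obtain ⟨h1, h2, -, -⟩ := (sector_tests p q).1 hpq
      rw [h1, h2]; push_cast
      exact ⟨Real.neg_one_le_cos ξ, Real.cos_le_one ξ⟩
    · obtain ⟨⟨t1, t2, t3⟩, -⟩ := (sector_tests p q).2 hpq
      refine sector_sin_of_values (abs_angle_sub_lt p q) gamma_range.1 gamma_range.2 (WSCC9.sin_angleOf_sub p q)
        (WSCC9.cos_angleOf_sub p q) cos_sin_gamma.1 cos_sin_gamma.2 ?_ ?_ ?_ ξ hξ
      · rw [← Rat.cast_abs]; exact_mod_cast t1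
      · rw [← Rat.cast_abs]; exact_mod_cast t2
      · rw [← Rat.cast_abs]; exact_mod_cast t3
  · rw [(cert_a_b _).1, (cert_a_b _).2]
    change ((aK (Sum.inr (p, q)) : ℚ) : ℝ) ≤ Real.cos ξ ∧ Real.cos ξ ≤ ((bK (Sum.inr (p, q)) : ℚ) : ℝ)
    simp only [InternalNode.splitShift, Sum.elim_inr] at hξ
    by_cases hpq : p = q
    · obtain ⟨-, -, h1, h2⟩ := (sector_tests p q).1 hpq
      rw [h1, h2]; push_cast
      exact ⟨Real.neg_one_le_cos ξ, Real.cos_le_one ξ⟩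
    · obtain ⟨-, ⟨t1, t2, t3⟩⟩ := (sector_tests p q).2 hpq
      refine sector_cos_of_values (abs_angle_sub_lt p q) gamma_range.2.le (WSCC9.sin_angleOf_sub p q)
        (WSCC9.cos_angleOf_sub p q) cos_sin_gamma.1 cos_sin_gamma.2 ?_ ?_ ?_ ξ hξ
      · exact_mod_cast t1
      · exact_mod_cast t2
      · exact_mod_cast t3

/-! ### The certified level -/

/-- **`hlev`**: the rank-one level passes on every channel — `lev ≤ c_rk ⇒ lev < γ²/s_k`
(`c_rk·s_k ≤ γ_lo² < γ²`). -/
theorem hlev {lev : ℝ} (hle : lev ≤ ((cRkQ : ℚ) : ℝ)) (k : (Fin 3 × Fin 3) ⊕ (Fin 3 × Fin 3)) :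
    lev < (2 * Real.arctan (1 / 50 : ℝ)) ^ 2 / ((sK k : ℚ) : ℝ) := by
  have hs : (0 : ℝ) < ((sK k : ℚ) : ℝ) := sK_pos k
  have ht : ((cRkQ : ℚ) : ℝ) * ((sK k : ℚ) : ℝ) ≤ ((gloQ : ℚ) : ℝ) ^ 2 := by
    unfold sK; exact_mod_cast (cRk_test (eκ k)).2
  have hg : ((gloQ : ℚ) : ℝ) ^ 2 < (2 * Real.arctan (1 / 50 : ℝ)) ^ 2 :=
    pow_lt_pow_left₀ gloQ_lt_gamma (by exact_mod_cast glo_test.1) two_ne_zero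
  rw [lt_div_iff₀ hs]
  nlinarith

/-! ### The slab in machine-angle terms -/

/-- The relative angle coordinates of the Lur'e state, extended by `0` at the reference machine. -/
private theorem ext0_lurieState (z : ClassicalSwing.State 3) (p : Fin 3) :
    InternalNode.ext0 ((WSCC9.postB_SPdamp.lurieState WSCC9.postB_SPdamp.angleOf z) ∘ Sum.inr) p
      = (z.1 p - z.1 0) - (WSCC9.postB_SPdamp.angleOf p - WSCC9.postB_SPdamp.angleOf 0) := by
  rw [RecastData.lurieState_eq]
  cases p using Fin.cases with
  | zero => simp
  | succ a => simp

/-- **Channel values of the Lur'e state**: channel `inl (p,q)` / `inr (p,q)` reads the machine-angle-difference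
deviation `(δ_p − δ_q) − (θ*_p − θ*_q)`. -/
theorem channel_lurieState (z : ClassicalSwing.State 3) (k : (Fin 3 × Fin 3) ⊕ (Fin 3 × Fin 3)) :
    (WSCC9.splitLurieSystem.C *ᵥ WSCC9.postB_SPdamp.lurieState WSCC9.postB_SPdamp.angleOf z) k
      = (z.1 (Sum.elim id id k).1 - z.1 (Sum.elim id id k).2)
        - (WSCC9.postB_SPdamp.angleOf (Sum.elim id id k).1 - WSCC9.postB_SPdamp.angleOf (Sum.elim id id k).2) := by
  rw [show WSCC9.splitLurieSystem = System.machineReference _ _ _ _ _ from rfl, System.machineReference_C_mulVec,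
    InternalNode.fromRows_pairIncidence_mulVec]
  rcases k with k | k
  · rw [Sum.elim_inl, InternalNode.pairIncidence_mulVec, ext0_lurieState, ext0_lurieState]
    simp only [Sum.elim_inl, id]
    ring
  · rw [Sum.elim_inr, InternalNode.pairIncidence_mulVec, ext0_lurieState, ext0_lurieState]
    simp only [Sum.elim_inr, id]
    ring

/-- **The slab in machine-angle terms**: the Lur'e state of `z = (δ, ω)` lies in the open slab `γ` iff every
machine-angle-difference deviation satisfies `|(δ_p − δ_q) − (θ*_p − θ*_q)| < γ`. -/
theorem mem_slab_iff (z : ClassicalSwing.State 3) (γ : ℝ) :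
    WSCC9.postB_SPdamp.lurieState WSCC9.postB_SPdamp.angleOf z ∈ WSCC9.splitLurieSystem.slab (fun _ => γ) ↔
      ∀ p q : Fin 3, |(z.1 p - z.1 q) - (WSCC9.postB_SPdamp.angleOf p - WSCC9.postB_SPdamp.angleOf q)| < γ := by
  simp only [System.slab, Set.mem_setOf_eq, channel_lurieState]
  constructor
  · intro h p q
    exact h (Sum.inl (p, q))
  · rintro h (⟨p, q⟩ | ⟨p, q⟩) <;> exact h p q

/-! ### The sentence -/

/-- **«G2.c-WSCC9-LOSSY-SLAB» (LANE F1) — the certified region of the post-fault WSCC 3-machine classical model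
WITH TRANSFER CONDUCTANCES.** For MODEL M′ = `WSCC9.postB_SPdamp.toModel` (post-fault-B Kron reduction, h12
couplings, `D_i/M_i = 1/10, 1/5, 3/10`, equilibrium `θ* = angleOf`): every solution `c` on `ℝ` whose initial
Lur'e state lies in the open slab `γ = 2·arctan(1/50)` (every `|(δ_p − δ_q) − (θ*_p − θ*_q)| < γ`,
`mem_slab_iff`) and has `V ≤ lev` for a level `lev ≤ c_rk = 1048155611943/4121792031250000`
(`V = xᵀPx + 2Σ_k λ_k∫₀^{y_k}F_k`, the slab Lyapunov function of sos-2's certificate `cert`) keeps BOTH for all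
`t ≥ 0`, and its Lur'e state `(ω₀, ω₁, ω₂ | (δ₁−δ₀) − (θ*₁−θ*₀), (δ₂−δ₀) − (θ*₂−θ*₀))` tends to `0`.
CERTIFIED for MODEL M′, CLASS = the well `{slab γ, V ≤ lev}` (inner estimate, a priori over all solutions; the
ε-level `c_ε = ε·γ_lo²/2 ≤ c_rk` is admissible); MODELLED «WSCC9-postB-SPdamp-h12» (MV-2 + MV-P + MV-SPD +
MV-ω + MV-h12, transfer conductances KEPT); VALIDATED: the SDP solve and the region-size data. Nothing here
says the WSCC system is stable.
[cite: Pai1981, §2.16 Theorem [18] eqs. (2.63)–(2.64), §3.6.3 eqs. (3.43)–(3.45); VuTuritsyn2017, §4.3 Theorem 1] -/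
theorem lossy_split_slab_roa {lev : ℝ} (hle : lev ≤ ((cRkQ : ℚ) : ℝ))
    {c : ℝ → ClassicalSwing.State 3} (hc : WSCC9.postB_SPdamp.toModel.IsSolutionOn c univ)
    (h0 : WSCC9.postB_SPdamp.lurieState WSCC9.postB_SPdamp.angleOf (c 0)
      ∈ WSCC9.splitLurieSystem.slab (fun _ => 2 * Real.arctan (1 / 50 : ℝ)))
    (h0c : cert.V (WSCC9.postB_SPdamp.lurieState WSCC9.postB_SPdamp.angleOf (c 0)) ≤ lev) :
    (∀ t, 0 ≤ t →
        WSCC9.postB_SPdamp.lurieState WSCC9.postB_SPdamp.angleOf (c t)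
            ∈ WSCC9.splitLurieSystem.slab (fun _ => 2 * Real.arctan (1 / 50 : ℝ)) ∧
          cert.V (WSCC9.postB_SPdamp.lurieState WSCC9.postB_SPdamp.angleOf (c t)) ≤ lev) ∧
      Tendsto (fun t => WSCC9.postB_SPdamp.lurieState WSCC9.postB_SPdamp.angleOf (c t)) atTop (𝓝 0) :=
  WSCC9.lossy_split_roa cert hsec (fun k => sK_pos k) rankOne (hlev hle) hc h0 h0c

/-- **The same, read in machine coordinates (synchronisation).** Under the hypotheses of
`lossy_split_slab_roa`: for all `t ≥ 0` every machine-angle-difference deviation stays `< 2·arctan(1/50)`;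
every speed deviation `ω_i(t) → 0`; every relative angle `δ_{a+1}(t) − δ_0(t) → θ*_{a+1} − θ*_0`.
MODELLED «WSCC9-postB-SPdamp-h12»; nothing here says the WSCC system is stable.
[cite: Pai1981, §3.6.3 eqs. (3.43)–(3.45); VuTuritsyn2017, §4.3 Theorem 1] -/
theorem lossy_split_slab_sync {lev : ℝ} (hle : lev ≤ ((cRkQ : ℚ) : ℝ))
    {c : ℝ → ClassicalSwing.State 3} (hc : WSCC9.postB_SPdamp.toModel.IsSolutionOn c univ)
    (h0 : ∀ p q : Fin 3, |((c 0).1 p - (c 0).1 q) - (WSCC9.postB_SPdamp.angleOf p - WSCC9.postB_SPdamp.angleOf q)|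
      < 2 * Real.arctan (1 / 50 : ℝ))
    (h0c : cert.V (WSCC9.postB_SPdamp.lurieState WSCC9.postB_SPdamp.angleOf (c 0)) ≤ lev) :
    (∀ t, 0 ≤ t → ∀ p q : Fin 3,
        |((c t).1 p - (c t).1 q) - (WSCC9.postB_SPdamp.angleOf p - WSCC9.postB_SPdamp.angleOf q)|
          < 2 * Real.arctan (1 / 50 : ℝ)) ∧
      (∀ i : Fin 3, Tendsto (fun t => (c t).2 i) atTop (𝓝 0)) ∧
      ∀ a : Fin 2, Tendsto (fun t => (c t).1 a.succ - (c t).1 0) atTop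
        (𝓝 (WSCC9.postB_SPdamp.angleOf a.succ - WSCC9.postB_SPdamp.angleOf 0)) := by
  obtain ⟨hkeep, hlim⟩ := lossy_split_slab_roa hle hc ((mem_slab_iff _ _).2 h0) h0c
  have hcoord := tendsto_pi_nhds.1 hlim
  refine ⟨fun t ht => (mem_slab_iff _ _).1 (hkeep t ht).1, fun i => ?_, fun a => ?_⟩
  · have h := hcoord (Sum.inl i)
    simp only [RecastData.lurieState_eq, Sum.elim_inl, Pi.zero_apply] at h
    exact h
  · have h := hcoord (Sum.inr a)
    simp only [RecastData.lurieState_eq, Sum.elim_inr, Pi.zero_apply] at h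
    have h2 := h.add_const (WSCC9.postB_SPdamp.angleOf a.succ - WSCC9.postB_SPdamp.angleOf 0)
    simp only [zero_add, sub_add_cancel] at h2
    exact h2

/-! ### APPEND (lyap-2 g0, 2026-08-27): the sentence WITH existence and uniqueness of the trajectory

`Models/ClassicalSwingGlobal.lean` (lyap-2 p518035): model-1's classical field WITH transfer conductances is
globally Lipschitz, so through every machine state passes exactly one solution of `WSCC9.postB_SPdamp.toModel`
on `univ`.  The a-priori sentence above therefore reads, for every machine state of the well: THE trajectory
exists, is unique, keeps the slab and the level, and synchronises. -/

/-- **«G2.c-WSCC9-LOSSY-SLAB» (LANE F1), well-posed form.** For MODEL M′ = `WSCC9.postB_SPdamp.toModel`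
(post-fault-B Kron reduction, transfer conductances KEPT, `D_i/M_i = 1/10, 1/5, 3/10`) and every machine state
`z = (δ, ω)` with all six `|(δ_p − δ_q) − (θ*_p − θ*_q)| < 2·arctan(1/50)` and `V(z) ≤ lev ≤ c_rk =
1048155611943/4121792031250000` (`V` = the slab Lyapunov function of sos-2's certificate `cert` read on the
Lur'e state): (i) a solution `c` of M′ on all of `ℝ` with `c 0 = z` EXISTS; (ii) every solution from `z` on
`univ` is that one (uniqueness); (iii) along it every machine-angle-difference deviation stays
`< 2·arctan(1/50)` and `V ≤ lev` for all `t ≥ 0`, every speed deviation `ω_i(t) → 0` and every relative angle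
`δ_{a+1}(t) − δ_0(t) → θ*_{a+1} − θ*_0`.  CERTIFIED for MODEL M′, CLASS = the well
`{slab 2·arctan(1/50), V ≤ lev}`; MODELLED «WSCC9-postB-SPdamp-h12» (MV-2 + MV-P + MV-SPD + MV-ω + MV-h12);
VALIDATED: the SDP solve and the region-size data. Nothing here says the WSCC system is stable.
[cite: Pai1981, §2.16 Theorem [18], §3.6.3 eqs. (3.43)–(3.45); VuTuritsyn2017, §4.3 Theorem 1; Hartman2002, Ch. III Thm. 5.1] -/
theorem lossy_split_slab_wellPosed {lev : ℝ} (hle : lev ≤ ((cRkQ : ℚ) : ℝ)) (z : ClassicalSwing.State 3)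
    (hz : ∀ p q : Fin 3, |(z.1 p - z.1 q) - (WSCC9.postB_SPdamp.angleOf p - WSCC9.postB_SPdamp.angleOf q)|
      < 2 * Real.arctan (1 / 50 : ℝ))
    (hzc : cert.V (WSCC9.postB_SPdamp.lurieState WSCC9.postB_SPdamp.angleOf z) ≤ lev) :
    (∃ c : ℝ → ClassicalSwing.State 3, c 0 = z ∧ WSCC9.postB_SPdamp.toModel.IsSolutionOn c univ) ∧
      ∀ c : ℝ → ClassicalSwing.State 3, c 0 = z → WSCC9.postB_SPdamp.toModel.IsSolutionOn c univ →
        (∀ c' : ℝ → ClassicalSwing.State 3, c' 0 = z → WSCC9.postB_SPdamp.toModel.IsSolutionOn c' univ →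
            c' = c) ∧
        (∀ t, 0 ≤ t →
          (∀ p q : Fin 3,
              |((c t).1 p - (c t).1 q) - (WSCC9.postB_SPdamp.angleOf p - WSCC9.postB_SPdamp.angleOf q)|
                < 2 * Real.arctan (1 / 50 : ℝ)) ∧
            cert.V (WSCC9.postB_SPdamp.lurieState WSCC9.postB_SPdamp.angleOf (c t)) ≤ lev) ∧
        (∀ i : Fin 3, Tendsto (fun t => (c t).2 i) atTop (𝓝 0)) ∧
        ∀ a : Fin 2, Tendsto (fun t => (c t).1 a.succ - (c t).1 0) atTop
          (𝓝 (WSCC9.postB_SPdamp.angleOf a.succ - WSCC9.postB_SPdamp.angleOf 0)) := by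
  refine ⟨WSCC9.postB_SPdamp_exists_solution z, fun c hc0 hc => ?_⟩
  have hkeep := lossy_split_slab_roa hle hc ((mem_slab_iff _ _).2 (hc0.symm ▸ hz)) (hc0.symm ▸ hzc)
  have hsync := lossy_split_slab_sync hle hc (hc0.symm ▸ hz) (hc0.symm ▸ hzc)
  refine ⟨fun c' hc0' hc' => WSCC9.postB_SPdamp_solution_unique hc' hc (hc0'.trans hc0.symm), ?_,
    hsync.2.1, hsync.2.2⟩
  intro t ht
  exact ⟨hsync.1 t ht, (hkeep.1 t ht).2⟩

end Summit.Ventures.GridStability.Bench.WSCC9LossySplitSlab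

end
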